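import Literature.MathematicalPhysics.QuantumFieldTheory.Balaban1983to89.B9Thm314WholeSummation

/-!
# `Balaban1983to89.B9Thm314WholePair` — [B9] Theorem 3.14 (pp. 426–427): the CANCELLATION LEAF of `B9Thm314Whole` (rows 22–23
# of the N06 certificate) over the PAIR of random-walk expansions of the two operators, from two Theorem-3.10 all-norms leaves

T. Bałaban, *Propagators for lattice gauge theories in a background field*, Commun. Math. Phys. **99** (1985) 389–434
[`Balaban1985BackgroundPropagators`, "B9"].

statement-level skeleton of published theorems with citation tags; proofs where landed; nothing here is a claim about the Yang–Mills mass gap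

THE PRINTED LOCI (verbatim).  p. 427 (the whole printed proof of Theorem 3.14): *"This theorem can be proved in exactly the same way
as the corresponding property in the theorem of [2]. We take random walk expansions for both operators, and in the difference all terms
for walks with localizations contained in Ω are cancelled. Remaining terms correspond to walks of the general type (3.107), for which at
least one localization X_i intersects Ωᶜ. Then the exponential factor in (3.108) gives the factor (3.154) (after adjusting a definition
of δ₀)."*; pp. 415–416, Theorem 3.10: *"the expansion (3.107) is convergent … [the ω-term] satisfies (3.108) and the corresponding
inequalities for norms on the left-hand sides of (3.42)–(3.47). The constant O(1) depends on d and L only"*.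

THE POINT.  `B9Thm314Whole` (seat n06-m g0) proves rows 22–23 from three leaves of the printed proof; its CANCELLATION LEAF
`DiffExpansionAllNorms c35 geo bg Ediff termK Touches` (GAPS G-B9-08) speaks of ONE expansion `Ediff` of the difference operator all of
whose walks touch Ωᶜ and whose terms obey (3.108) in all norms.  Print builds that expansion from TWO: *"We take random walk expansions
for both operators"* — the Theorem-3.10 expansions (3.107) of G(Ω, U) and of G(Ω′, U) — and keeps, after the cancellation, the walks of
EITHER that touch Ωᶜ.  THIS FILE types exactly that construction and kernel-checks the leaf for it:
* §1 `pairExpansion E₁ E₂ T₁ T₂` — the expansion whose walks are the walks of `E₁` satisfying `T₁` and the walks of `E₂` satisfying `T₂`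
  (a `Sum` of subtypes), lengths ∕ end-points ∕ distances ∕ terms ∕ localisation inherited, `Converges U := E₁.Converges U ∧ E₂.Converges U`;
  `pairTermK` (the walk terms' quantities, inherited); `locData₂` (the second sequence's localisation data over the first one's point
  set of T) and `pairLocData` (the geometry of (3.93)∕(3.154) for the pair) with `pairLocData_laws`, `pairLocData_touches` (with
  `T₁`, `T₂` := «touches Ωᶜ», EVERY walk of the pair touches Ωᶜ — by construction: this is where *"all terms for walks with localizations
  contained in Ω are cancelled"* is USED; the cancellation itself is an identity of OPERATORS and lives in the reading of `Converges` for
  the difference family at the instance, cf. `B9Thm314WholeSummation.DominatedBySums`);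
* §2 kernel-checked weakenings — `walkFactor_mono`, `termIneq342_346_mono`, `termIneq343_345_mono` (common constants for the two
  sequences: C = max, c = max, δ₀ = min, Hölder constants max(·, ·, 0); needs d(ω, y, y′) ≥ 0, `wdist_nonneg_of_laws`);
* §3 ★ `diffExpansionAllNorms_pair` — the cancellation leaf of `B9Thm314Whole` for the pair expansion PROVED from the two Theorem-3.10
  all-norms leaves `B9SectCWalkTermsAllNorms.Thm310AllNormsPrinted c35 geo bg E₁ termK₁` ∕ `… E₂ termK₂` (the typer's row-18 currency, one
  per sequence) — thresholds max M₂, min a₀;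
* §4 the ROW FACES over the pair: ★ `thm314LocalPrinted_of_pair` (row 23), ★ `thm314Printed_of_pair` (row 22), `thm314_pair_of_pair` —
  g0's `thm314LocalPrinted_of_leaves` ∕ `thm314Printed_of_leaves_allNorms` with `hA` SUPPLIED by §3; displayed: the two Thm-3.10 leaves, the
  geometry (`LocData` of sequence 1, the second sequence's walk data and its laws), the M-uniform diameter bound `hr` (typed-leaf flag
  T314 (ii) STANDS), the two summation-with-factor leaves `hS hH` for the pair;
* §5 the same rows with the summation leaves REPLACED by their structural reading (`B9Thm314WholeSummation`, p470425): ★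
  `thm314_pair_of_pair_reading` (rows 22 ∧ 23) — displayed: the two Thm-3.10 leaves, the geometry, `hr`, and the reading (`WalkSetsSpec`,
  `WalkWeightsSummable`, `DominatedBySums`) for the pair's walk sets.

HONEST SCOPE.  Count-neutral kernel bookkeeping: the cancellation leaf is REDUCED to two Theorem-3.10-type leaves (hypotheses of printed
shape about the two sequences' expansions — at the record the first is the layer's `E310`-type letter, the second sequence's expansion is
a further letter) plus structure; the operator identity behind the cancellation is NOT asserted here (it belongs to the instance's reading
of `Converges` for `Kdiff`).  Nothing of print is asserted; NOT a node discharge, NOT summit progress; one finite lattice programme; nothing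
continuum, nothing about the mass gap.  Cell `pub-ymgap` (D-0062), node N06 [B9], N06-ASSIGNMENT v1 rows 22–23 (successor file of bundle F8),
seat `pub-ymgap-dag-n06-m` (g2), 2026-08-26.
-/

namespace Literature.MathematicalPhysics.QuantumFieldTheory.Balaban1983to89.B9Thm314WholePair

open B9 B9Thm314 B9Thm314Whole B9Thm314WholeSummation B9SectCWalkTermsAllNorms B9FromB6ModelSignsOn

/-! ## §1 The pair of expansions: *"We take random walk expansions for both operators"* -/

section Pair

variable {g : Geometry} {B : Backgrounds}

/-- **THE EXPANSION OF THE DIFFERENCE, FROM THE PAIR** (p. 427): its walks are the walks of `E₁` (the expansion of the operator for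
{Ω_j}) satisfying `T₁` together with the walks of `E₂` (for {Ω′_j}) satisfying `T₂` — in print `T₁`, `T₂` = «at least one localization
X_i intersects Ωᶜ», the walks surviving the cancellation; lengths, end-points, the distance d(ω, y, y′), the terms and the U-localisation
are inherited; `Converges U` := both expansions converge at U. [cite: Balaban1985BackgroundPropagators, Thm 3.14 proof p.427 + Thm 3.10 (3.107) p.415] -/
def pairExpansion (E₁ E₂ : RWExpansion g B) (T₁ : E₁.Walk → Prop) (T₂ : E₂.Walk → Prop) : RWExpansion g B where
  Walk := {ω : E₁.Walk // T₁ ω} ⊕ {ω : E₂.Walk // T₂ ω}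
  wlen := Sum.elim (fun ω => E₁.wlen ω.1) (fun ω => E₂.wlen ω.1)
  first := Sum.elim (fun ω => E₁.first ω.1) (fun ω => E₂.first ω.1)
  last := Sum.elim (fun ω => E₁.last ω.1) (fun ω => E₂.last ω.1)
  wdist := Sum.elim (fun ω => E₁.wdist ω.1) (fun ω => E₂.wdist ω.1)
  term := fun U => Sum.elim (fun ω => E₁.term U ω.1) (fun ω => E₂.term U ω.1)
  LocDep := fun U => Sum.elim (fun ω => E₁.LocDep U ω.1) (fun ω => E₂.LocDep U ω.1)
  Converges := fun U => E₁.Converges U ∧ E₂.Converges U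

/-- **THE WALK TERMS' QUANTITIES, INHERITED** (the ω-terms of the difference are ± the ω-terms of the two expansions; their (3.42)–(3.46)
quantities are those of the latter). [cite: Balaban1985BackgroundPropagators, Thm 3.14 proof p.427 + (3.108) p.416] -/
def pairTermK (E₁ E₂ : RWExpansion g B) (T₁ : E₁.Walk → Prop) (T₂ : E₂.Walk → Prop)
    (termK₁ : E₁.Walk → KernelFamily g B) (termK₂ : E₂.Walk → KernelFamily g B) :
    (pairExpansion E₁ E₂ T₁ T₂).Walk → KernelFamily g B :=
  Sum.elim (fun ω => termK₁ ω.1) (fun ω => termK₂ ω.1)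

/-- **THE SECOND SEQUENCE'S LOCALISATION DATA OVER THE FIRST ONE'S POINT SET** (same torus T, same |·|, same Ωᶜ ∩ T^{(k)}, same diameter
bound; only the walk-dependent fields — the 𝔅-points of the localisation domains `X₂` and «X_m ∩ Ωᶜ ≠ ∅» `Meets₂` — are the second
expansion's). [cite: Balaban1985BackgroundPropagators, (3.154) p.427 + (3.107) p.415 (dictionary)] -/
def locData₂ {E₁ E₂ : RWExpansion g B} (D₁ : LocData g B E₁) (X₂ : E₂.Walk → ℕ → g.Site → Prop) (Meets₂ : E₂.Walk → ℕ → Prop) :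
    LocData g B E₂ where
  Pt := D₁.Pt
  ι := D₁.ι
  ρ := D₁.ρ
  inΩc := D₁.inΩc
  X := X₂
  Meets := Meets₂
  diam := D₁.diam

/-- **THE GEOMETRY OF (3.93)∕(3.154) FOR THE PAIR**: point set, |·|, Ωᶜ ∩ T^{(k)} and the diameter bound of the first sequence's data; the
localisation domains and their meeting Ωᶜ walk by walk from the respective sequence. [cite: Balaban1985BackgroundPropagators, (3.93) p.410 + (3.154) p.427] -/
def pairLocData {E₁ E₂ : RWExpansion g B} (D₁ : LocData g B E₁) (X₂ : E₂.Walk → ℕ → g.Site → Prop) (Meets₂ : E₂.Walk → ℕ → Prop)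
    (T₁ : E₁.Walk → Prop) (T₂ : E₂.Walk → Prop) : LocData g B (pairExpansion E₁ E₂ T₁ T₂) where
  Pt := D₁.Pt
  ι := D₁.ι
  ρ := D₁.ρ
  inΩc := D₁.inΩc
  X := Sum.elim (fun ω => D₁.X ω.1) (fun ω => X₂ ω.1)
  Meets := Sum.elim (fun ω => D₁.Meets ω.1) (fun ω => Meets₂ ω.1)
  diam := D₁.diam

variable {E₁ E₂ : RWExpansion g B}

/-- The pair's geometry obeys the laws (`B9Thm314.LocData.Laws`) when both sequences' data do (the second over the first one's point set).
[cite: Balaban1985BackgroundPropagators, (3.93) p.410 + (3.154) p.427 (bookkeeping)] -/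
theorem pairLocData_laws (D₁ : LocData g B E₁) {X₂ : E₂.Walk → ℕ → g.Site → Prop} {Meets₂ : E₂.Walk → ℕ → Prop}
    {dOmega : g.Site → g.Site → ℝ} (L₁ : D₁.Laws dOmega) (L₂ : (locData₂ D₁ X₂ Meets₂).Laws dOmega)
    (T₁ : E₁.Walk → Prop) (T₂ : E₂.Walk → Prop) : (pairLocData D₁ X₂ Meets₂ T₁ T₂).Laws dOmega where
  ρ_self := L₁.ρ_self
  ρ_symm := L₁.ρ_symm
  ρ_triangle := L₁.ρ_triangle
  d_triangle := L₁.d_triangle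
  cmp := L₁.cmp
  dOmega_le := L₁.dOmega_le
  near := by
    rintro (ω | ω) m p hm hX
    · exact L₁.near ω.1 m p hm hX
    · exact L₂.near ω.1 m p hm hX
  first_mem := by
    rintro (ω | ω) y hy
    · exact L₁.first_mem ω.1 y hy
    · exact L₂.first_mem ω.1 y hy
  chain := by
    rintro (ω | ω) y y' hy hy'
    · exact L₁.chain ω.1 y y' hy hy'
    · exact L₂.chain ω.1 y y' hy hy'

/-- **EVERY WALK OF THE PAIR TOUCHES Ωᶜ** when the restrictions are «touches Ωᶜ» for the respective data (p. 427: *"Remaining terms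
correspond to walks … for which at least one localization X_i intersects Ωᶜ"*) — by construction. [cite: Balaban1985BackgroundPropagators, Thm 3.14 proof p.427] -/
theorem pairLocData_touches (D₁ : LocData g B E₁) (X₂ : E₂.Walk → ℕ → g.Site → Prop) (Meets₂ : E₂.Walk → ℕ → Prop) :
    ∀ ω, (pairLocData D₁ X₂ Meets₂ D₁.Touches (locData₂ D₁ X₂ Meets₂).Touches).Touches ω := by
  rintro (ω | ω)
  · exact ω.2
  · exact ω.2

end Pair

/-! ## §2 Kernel-checked weakenings: common constants for the two sequences -/

section Mono

variable {g : Geometry} {B : Backgrounds} {E : RWExpansion g B} {termK : E.Walk → KernelFamily g B} {U : B.Cfg}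
  {Ps : g.Loc → Prop}

/-- **The walk factor of (3.94)∕(3.108) is monotone**: constant up (to a nonnegative one), the O(1) of O(1)M^{−1/2} up, rate down —
for d(ω, y, y′) ≥ 0. [cite: Balaban1985BackgroundPropagators, (3.94) p.410 + (3.108) p.416 (bookkeeping)] -/
theorem walkFactor_mono {C C' c c' M δ δ' dω : ℝ} {n : ℕ} (hC : C ≤ C') (hC' : 0 ≤ C') (hc : 0 ≤ c) (hcc : c ≤ c')
    (hM : 0 < M) (hδ : δ' ≤ δ) (hd : 0 ≤ dω) : walkFactor C c M δ n dω ≤ walkFactor C' c' M δ' n dω := by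
  unfold walkFactor
  have hr : 0 ≤ M ^ (-(1 / 2 : ℝ)) := Real.rpow_nonneg hM.le _
  have hX : 0 ≤ (c * M ^ (-(1 / 2 : ℝ))) ^ n := pow_nonneg (mul_nonneg hc hr) n
  have hX' : 0 ≤ (c' * M ^ (-(1 / 2 : ℝ))) ^ n := pow_nonneg (mul_nonneg (hc.trans hcc) hr) n
  have hY : 0 ≤ M ^ (-((n : ℝ) / 2)) := Real.rpow_nonneg hM.le _
  have hZ : 0 ≤ Real.exp (-(δ / 2 * dω)) := Real.exp_nonneg _
  have hpow : (c * M ^ (-(1 / 2 : ℝ))) ^ n ≤ (c' * M ^ (-(1 / 2 : ℝ))) ^ n :=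
    pow_le_pow_left₀ (mul_nonneg hc hr) (mul_le_mul_of_nonneg_right hcc hr) n
  have hexp : Real.exp (-(δ / 2 * dω)) ≤ Real.exp (-(δ' / 2 * dω)) :=
    Real.exp_le_exp.2 (neg_le_neg (mul_le_mul_of_nonneg_right (by linarith) hd))
  calc C * (c * M ^ (-(1 / 2 : ℝ))) ^ n * M ^ (-((n : ℝ) / 2)) * Real.exp (-(δ / 2 * dω))
      ≤ C' * (c * M ^ (-(1 / 2 : ℝ))) ^ n * M ^ (-((n : ℝ) / 2)) * Real.exp (-(δ / 2 * dω)) :=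
        mul_le_mul_of_nonneg_right (mul_le_mul_of_nonneg_right (mul_le_mul_of_nonneg_right hC hX) hY) hZ
    _ ≤ C' * (c' * M ^ (-(1 / 2 : ℝ))) ^ n * M ^ (-((n : ℝ) / 2)) * Real.exp (-(δ / 2 * dω)) :=
        mul_le_mul_of_nonneg_right (mul_le_mul_of_nonneg_right (mul_le_mul_of_nonneg_left hpow hC') hY) hZ
    _ ≤ C' * (c' * M ^ (-(1 / 2 : ℝ))) ^ n * M ^ (-((n : ℝ) / 2)) * Real.exp (-(δ' / 2 * dω)) :=
        mul_le_mul_of_nonneg_left hexp (mul_nonneg (mul_nonneg hC' hX') hY)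

/-- **Weakening the per-walk sup∕L² blocks (3.108)** to larger constants C′ ≥ C, c′ ≥ c and a smaller rate δ′ ≤ δ (prefactors and argument
sizes ≥ 0 by the model signs; d(ω, y, y′) ≥ 0 on walks from y to y′). [cite: Balaban1985BackgroundPropagators, Thm 3.10 (3.108) p.416 (bookkeeping)] -/
theorem termIneq342_346_mono (S : ModelSignsOn g Ps) {C C' c c' δ δ' : ℝ} (hC : C ≤ C') (hC' : 0 ≤ C') (hc : 0 ≤ c) (hcc : c ≤ c')
    (hM : 0 < g.M) (hδ : δ' ≤ δ) (hwd : ∀ ω y y', E.first ω y → E.last ω y' → 0 ≤ E.wdist ω y y')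
    (h : TermIneq342_346 E termK C c δ U) : TermIneq342_346 E termK C' c' δ' U := by
  refine ⟨fun ω n lam y y' hf hl hs => ?_, fun ω n lam hc' y y' hf hl hcut hs => ?_⟩
  · exact (h.1 ω n lam y y' hf hl hs).trans (mul_le_mul_of_nonneg_right
      (mul_le_mul_of_nonneg_left (walkFactor_mono hC hC' hc hcc hM hδ (hwd ω y y' hf hl))
        (B9FromB6.pref4_nonneg (S.len_nonneg y) n)) (S.supNorm_nonneg lam))
  · exact (h.2 ω n lam hc' y y' hf hl hcut hs).trans (mul_le_mul_of_nonneg_right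
      (mul_le_mul_of_nonneg_left (walkFactor_mono hC hC' hc hcc hM hδ (hwd ω y y' hf hl))
        (mul_nonneg (B9FromB6.pref6_nonneg (S.len_nonneg y) n) (S.cutSup_nonneg hc'))) (S.l2Norm_nonneg lam))

/-- **Weakening the per-walk Hölder blocks** to pointwise larger, nonnegative constant functions, a larger O(1) and a smaller rate.
[cite: Balaban1985BackgroundPropagators, Thm 3.10 p.416 + (3.43)–(3.45) p.398 (bookkeeping)] -/
theorem termIneq343_345_mono (S : ModelSignsOn g Ps) {c c' δ δ' : ℝ} {Bβ Bβ' Bε Bε' : ℝ → ℝ} {Bεβ Bεβ' : ℝ → ℝ → ℝ}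
    (hβ : ∀ β, Bβ β ≤ Bβ' β) (hβ' : ∀ β, 0 ≤ Bβ' β) (hε : ∀ ε, Bε ε ≤ Bε' ε) (hε' : ∀ ε, 0 ≤ Bε' ε)
    (hεβ : ∀ ε β, Bεβ ε β ≤ Bεβ' ε β) (hεβ' : ∀ ε β, 0 ≤ Bεβ' ε β) (hc : 0 ≤ c) (hcc : c ≤ c') (hM : 0 < g.M) (hδ : δ' ≤ δ)
    (hwd : ∀ ω y y', E.first ω y → E.last ω y' → 0 ≤ E.wdist ω y y')
    (h : TermIneq343_345 E termK c δ Bβ Bε Bεβ U) : TermIneq343_345 E termK c' δ' Bβ' Bε' Bεβ' U := by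
  have hhs (ε : ℝ) (lam : g.Loc) : 0 ≤ g.holder ε lam + g.supNorm lam := add_nonneg (S.holder_nonneg ε lam) (S.supNorm_nonneg lam)
  refine ⟨fun ω β lam ζ y y' hβ0 hβ1 hf hl hcut hs => ?_, fun ω ε lam y y' hε0 hε1 hf hl hs => ?_,
    fun ω ε β lam ζ y y' hε0 hε1 hβ0 hβ1 hf hl hcut hs => ?_⟩
  · exact (h.1 ω β lam ζ y y' hβ0 hβ1 hf hl hcut hs).trans (mul_le_mul_of_nonneg_right
      (mul_le_mul_of_nonneg_left (walkFactor_mono (hβ β) (hβ' β) hc hcc hM hδ (hwd ω y y' hf hl))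
        (mul_nonneg (Real.rpow_nonneg (S.len_nonneg y) _) (S.cutH_nonneg β ζ))) (S.supNorm_nonneg lam))
  · exact (h.2.1 ω ε lam y y' hε0 hε1 hf hl hs).trans (mul_le_mul_of_nonneg_right
      (walkFactor_mono (hε ε) (hε' ε) hc hcc hM hδ (hwd ω y y' hf hl)) (hhs ε lam))
  · exact (h.2.2 ω ε β lam ζ y y' hε0 hε1 hβ0 hβ1 hf hl hcut hs).trans (mul_le_mul_of_nonneg_right
      (mul_le_mul_of_nonneg_left (walkFactor_mono (hεβ ε β) (hεβ' ε β) hc hcc hM hδ (hwd ω y y' hf hl))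
        (mul_nonneg (Real.rpow_nonneg (S.len_nonneg y) _) (S.cutH_nonneg β ζ))) (hhs (β + ε) lam))

/-- **d(ω, y, y′) ≥ 0** for a walk from y to y′, from the geometry laws (d(y, y′) ≤ d(ω, y, y′),
`B9Thm314WholeSummation.dist_le_wdist_of_laws`, and the model sign of d). [cite: Balaban1985BackgroundPropagators, (3.93) p.410 (bookkeeping)] -/
theorem wdist_nonneg_of_laws (D : LocData g B E) {dOmega : g.Site → g.Site → ℝ} (L : D.Laws dOmega) (S : ModelSignsOn g Ps)
    {ω : E.Walk} {y y' : g.Site} (hy : E.first ω y) (hy' : E.last ω y') : 0 ≤ E.wdist ω y y' :=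
  (S.dist_nonneg y y').trans (dist_le_wdist_of_laws D L hy hy')

end Mono

/-! ## §3 The cancellation leaf of `B9Thm314Whole` for the pair, from two Theorem-3.10 all-norms leaves -/

section Cancellation

variable {I : Type} {c35 : ℝ} {geo : I → Geometry} {bg : I → Backgrounds}
  {E₁ E₂ : ∀ i, RWExpansion (geo i) (bg i)}
  {termK₁ : ∀ i, (E₁ i).Walk → KernelFamily (geo i) (bg i)} {termK₂ : ∀ i, (E₂ i).Walk → KernelFamily (geo i) (bg i)}
  {Ps : ∀ i, (geo i).Loc → Prop}

/-- ★ **THE CANCELLATION LEAF OVER THE PAIR, PROVED** (p. 427: *"We take random walk expansions for both operators, and in the difference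
all terms for walks with localizations contained in Ω are cancelled. Remaining terms correspond to walks of the general type (3.107) …"*):
if the two sequences' expansions obey Theorem 3.10 with its all-norms clause (`Thm310AllNormsPrinted`, one leaf per sequence), every walk of
the pair touches Ωᶜ (`htouch` — by construction when the restrictions are «touches Ωᶜ», `pairLocData_touches`), and d(ω, y, y′) ≥ 0 on
walks from y to y′, then the pair expansion with the inherited term quantities satisfies `B9Thm314Whole.DiffExpansionAllNorms` — thresholds
max M₂, min a₀, rate min δ₀, constants max C, max c, Hölder constants max(·, ·, 0).  Nothing of print asserted.
[cite: Balaban1985BackgroundPropagators, Thm 3.14 proof p.427 + Thm 3.10 (3.107)–(3.108) pp.415–416] -/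
theorem diffExpansionAllNorms_pair (T₁ : ∀ i, (E₁ i).Walk → Prop) (T₂ : ∀ i, (E₂ i).Walk → Prop)
    (Touches : ∀ i, (pairExpansion (E₁ i) (E₂ i) (T₁ i) (T₂ i)).Walk → Prop) (htouch : ∀ i ω, Touches i ω)
    (S : ∀ i, ModelSignsOn (geo i) (Ps i))
    (hwd₁ : ∀ (i : I) (ω : (E₁ i).Walk) (y y' : (geo i).Site), (E₁ i).first ω y → (E₁ i).last ω y' → 0 ≤ (E₁ i).wdist ω y y')
    (hwd₂ : ∀ (i : I) (ω : (E₂ i).Walk) (y y' : (geo i).Site), (E₂ i).first ω y → (E₂ i).last ω y' → 0 ≤ (E₂ i).wdist ω y y')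
    (h₁ : Thm310AllNormsPrinted c35 geo bg E₁ termK₁) (h₂ : Thm310AllNormsPrinted c35 geo bg E₂ termK₂) :
    DiffExpansionAllNorms c35 geo bg (fun i => pairExpansion (E₁ i) (E₂ i) (T₁ i) (T₂ i))
      (fun i => pairTermK (E₁ i) (E₂ i) (T₁ i) (T₂ i) (termK₁ i) (termK₂ i)) Touches := by
  obtain ⟨M₁, a₁, δ₁, C₁, c₁, Bβ₁, Bε₁, Bεβ₁, hM₁, ha₁, hδ₁, hC₁, hc₁, H₁⟩ := h₁
  obtain ⟨M₂, a₂, δ₂, C₂, c₂, Bβ₂, Bε₂, Bεβ₂, hM₂, ha₂, hδ₂, hC₂, hc₂, H₂⟩ := h₂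
  refine ⟨max M₁ M₂, min a₁ a₂, min δ₁ δ₂, max C₁ C₂, max c₁ c₂, fun β => max (max (Bβ₁ β) (Bβ₂ β)) 0,
    fun ε => max (max (Bε₁ ε) (Bε₂ ε)) 0, fun ε β => max (max (Bεβ₁ ε β) (Bεβ₂ ε β)) 0, lt_max_of_lt_left hM₁,
    lt_min ha₁ ha₂, lt_min hδ₁ hδ₂, lt_max_of_lt_left hC₁, lt_max_of_lt_left hc₁, fun β => le_max_right _ _,
    fun ε => le_max_right _ _, fun ε β => le_max_right _ _, fun i hMi α₀ hα hMa U hU => ?_⟩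
  have hMpos : 0 < (geo i).M := lt_of_lt_of_le hM₁ ((le_max_left _ _).trans hMi)
  obtain ⟨hconv₁, -, h42₁, h43₁⟩ := H₁ i ((le_max_left _ _).trans hMi) α₀ hα (hMa.trans (min_le_left _ _)) U hU
  obtain ⟨hconv₂, -, h42₂, h43₂⟩ := H₂ i ((le_max_right _ _).trans hMi) α₀ hα (hMa.trans (min_le_right _ _)) U hU
  -- both sequences' blocks at the common constants
  have h42₁' := termIneq342_346_mono (S i) (le_max_left C₁ C₂) (hC₁.le.trans (le_max_left _ _)) hc₁.le (le_max_left c₁ c₂)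
    hMpos (min_le_left δ₁ δ₂) (hwd₁ i) h42₁
  have h42₂' := termIneq342_346_mono (S i) (le_max_right C₁ C₂) (hC₁.le.trans (le_max_left _ _)) hc₂.le (le_max_right c₁ c₂)
    hMpos (min_le_right δ₁ δ₂) (hwd₂ i) h42₂
  have h43₁' := termIneq343_345_mono (S i) (Bβ' := fun β => max (max (Bβ₁ β) (Bβ₂ β)) 0)
    (Bε' := fun ε => max (max (Bε₁ ε) (Bε₂ ε)) 0) (Bεβ' := fun ε β => max (max (Bεβ₁ ε β) (Bεβ₂ ε β)) 0)
    (fun β => (le_max_left _ _).trans (le_max_left _ _)) (fun β => le_max_right _ _)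
    (fun ε => (le_max_left _ _).trans (le_max_left _ _)) (fun ε => le_max_right _ _)
    (fun ε β => (le_max_left _ _).trans (le_max_left _ _)) (fun ε β => le_max_right _ _)
    hc₁.le (le_max_left c₁ c₂) hMpos (min_le_left δ₁ δ₂) (hwd₁ i) h43₁
  have h43₂' := termIneq343_345_mono (S i) (Bβ' := fun β => max (max (Bβ₁ β) (Bβ₂ β)) 0)
    (Bε' := fun ε => max (max (Bε₁ ε) (Bε₂ ε)) 0) (Bεβ' := fun ε β => max (max (Bεβ₁ ε β) (Bεβ₂ ε β)) 0)
    (fun β => (le_max_right _ _).trans (le_max_left _ _)) (fun β => le_max_right _ _)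
    (fun ε => (le_max_right _ _).trans (le_max_left _ _)) (fun ε => le_max_right _ _)
    (fun ε β => (le_max_right _ _).trans (le_max_left _ _)) (fun ε β => le_max_right _ _)
    hc₂.le (le_max_right c₁ c₂) hMpos (min_le_right δ₁ δ₂) (hwd₂ i) h43₂
  refine ⟨⟨hconv₁, hconv₂⟩, htouch i, ⟨?_, ?_⟩, ⟨?_, ?_, ?_⟩⟩
  · rintro (ω | ω) n lam y y' hf hl hs
    · exact h42₁'.1 ω.1 n lam y y' hf hl hs
    · exact h42₂'.1 ω.1 n lam y y' hf hl hs
  · rintro (ω | ω) n lam h y y' hf hl hcut hs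
    · exact h42₁'.2 ω.1 n lam h y y' hf hl hcut hs
    · exact h42₂'.2 ω.1 n lam h y y' hf hl hcut hs
  · rintro (ω | ω) β lam ζ y y' hβ0 hβ1 hf hl hcut hs
    · exact h43₁'.1 ω.1 β lam ζ y y' hβ0 hβ1 hf hl hcut hs
    · exact h43₂'.1 ω.1 β lam ζ y y' hβ0 hβ1 hf hl hcut hs
  · rintro (ω | ω) ε lam y y' hε0 hε1 hf hl hs
    · exact h43₁'.2.1 ω.1 ε lam y y' hε0 hε1 hf hl hs
    · exact h43₂'.2.1 ω.1 ε lam y y' hε0 hε1 hf hl hs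
  · rintro (ω | ω) ε β lam ζ y y' hε0 hε1 hβ0 hβ1 hf hl hcut hs
    · exact h43₁'.2.2 ω.1 ε β lam ζ y y' hε0 hε1 hβ0 hβ1 hf hl hcut hs
    · exact h43₂'.2.2 ω.1 ε β lam ζ y y' hε0 hε1 hβ0 hβ1 hf hl hcut hs

end Cancellation

/-! ## §4 Rows 23 and 22 of the certificate over the pair -/

section Rows

variable {I : Type} {c35 : ℝ} {geo : I → Geometry} {bg : I → Backgrounds} {Kdiff : ∀ i, KernelFamily (geo i) (bg i)}
  {OmK : ∀ i, (geo i).Site → Prop} {dOmega : ∀ i, (geo i).Site → (geo i).Site → ℝ}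
  {E₁ E₂ : ∀ i, RWExpansion (geo i) (bg i)}
  {termK₁ : ∀ i, (E₁ i).Walk → KernelFamily (geo i) (bg i)} {termK₂ : ∀ i, (E₂ i).Walk → KernelFamily (geo i) (bg i)}
  {Ps : ∀ i, (geo i).Loc → Prop}

/-- ★ **ROW 23 — THEOREM 3.14, LOCAL READING, OVER THE PAIR OF EXPANSIONS**: `B9Thm314Whole.thm314LocalPrinted_of_leaves` at the pair
expansion (walks of either sequence touching Ωᶜ) with its cancellation leaf `hA` SUPPLIED by `diffExpansionAllNorms_pair` from the two
Theorem-3.10 all-norms leaves `h₁`, `h₂`.  Displayed: the first sequence's localisation data `D₁` with its laws, the second sequence's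
walk data `X₂`, `Meets₂` with its laws over the same point set, the M-uniform diameter bound `hr` (typed-leaf flag T314 (ii) STANDS),
the model signs, d(·,·,Ω) ≥ 0, and the two summation-with-factor leaves `hS`, `hH` for the pair (their structural reading:
`B9Thm314WholeSummation`).  Nothing of print asserted; NOT a node discharge. [cite: Balaban1985BackgroundPropagators, Thm 3.14 (3.154) pp.426–427] -/
theorem thm314LocalPrinted_of_pair (D₁ : ∀ i, LocData (geo i) (bg i) (E₁ i))
    (X₂ : ∀ i, (E₂ i).Walk → ℕ → (geo i).Site → Prop) (Meets₂ : ∀ i, (E₂ i).Walk → ℕ → Prop)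
    (L₁ : ∀ i, (D₁ i).Laws (dOmega i)) (L₂ : ∀ i, (locData₂ (D₁ i) (X₂ i) (Meets₂ i)).Laws (dOmega i)) (r₀ : ℝ)
    (hr : ∀ i, (D₁ i).diam ≤ r₀) (S : ∀ i, ModelSignsOn (geo i) (Ps i)) (hdΩ : ∀ (i : I) (y y' : (geo i).Site), 0 ≤ dOmega i y y')
    (h₁ : Thm310AllNormsPrinted c35 geo bg E₁ termK₁) (h₂ : Thm310AllNormsPrinted c35 geo bg E₂ termK₂)
    (hS : RWSumFactorYieldsSupL2 geo bg
      (fun i => pairExpansion (E₁ i) (E₂ i) (D₁ i).Touches (locData₂ (D₁ i) (X₂ i) (Meets₂ i)).Touches)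
      (fun i => pairTermK (E₁ i) (E₂ i) _ _ (termK₁ i) (termK₂ i)) Kdiff OmK)
    (hH : RWSumFactorYieldsHolder geo bg
      (fun i => pairExpansion (E₁ i) (E₂ i) (D₁ i).Touches (locData₂ (D₁ i) (X₂ i) (Meets₂ i)).Touches)
      (fun i => pairTermK (E₁ i) (E₂ i) _ _ (termK₁ i) (termK₂ i)) Kdiff OmK) :
    Thm314LocalPrinted c35 geo bg Kdiff OmK dOmega :=
  thm314LocalPrinted_of_leaves (fun i => pairLocData (D₁ i) (X₂ i) (Meets₂ i) _ _)
    (fun i => pairLocData_laws (D₁ i) (L₁ i) (L₂ i) _ _) r₀ hr S hdΩ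
    (diffExpansionAllNorms_pair _ _ _ (fun i => pairLocData_touches (D₁ i) (X₂ i) (Meets₂ i)) S
      (fun i _ _ _ hy hy' => wdist_nonneg_of_laws (D₁ i) (L₁ i) (S i) hy hy')
      (fun i _ _ _ hy hy' => wdist_nonneg_of_laws _ (L₂ i) (S i) hy hy') h₁ h₂) hS hH

/-- ★ **ROW 22 — THEOREM 3.14 AS THE LEAF FIELD `B9.Thm314Printed`, OVER THE PAIR** (sup entries, no localisation restriction):
`B9Thm314Whole.thm314Printed_of_leaves_allNorms` with `hA` supplied by `diffExpansionAllNorms_pair`; the unrestricted sup∕L² summation leaf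
for the pair stays displayed. [cite: Balaban1985BackgroundPropagators, Thm 3.14 (3.154) pp.426–427] -/
theorem thm314Printed_of_pair (D₁ : ∀ i, LocData (geo i) (bg i) (E₁ i))
    (X₂ : ∀ i, (E₂ i).Walk → ℕ → (geo i).Site → Prop) (Meets₂ : ∀ i, (E₂ i).Walk → ℕ → Prop)
    (L₁ : ∀ i, (D₁ i).Laws (dOmega i)) (L₂ : ∀ i, (locData₂ (D₁ i) (X₂ i) (Meets₂ i)).Laws (dOmega i)) (r₀ : ℝ)
    (hr : ∀ i, (D₁ i).diam ≤ r₀) (S : ∀ i, ModelSignsOn (geo i) (Ps i)) (hdΩ : ∀ (i : I) (y y' : (geo i).Site), 0 ≤ dOmega i y y')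
    (h₁ : Thm310AllNormsPrinted c35 geo bg E₁ termK₁) (h₂ : Thm310AllNormsPrinted c35 geo bg E₂ termK₂)
    (hSu : RWSumFactorYieldsSupL2 geo bg
      (fun i => pairExpansion (E₁ i) (E₂ i) (D₁ i).Touches (locData₂ (D₁ i) (X₂ i) (Meets₂ i)).Touches)
      (fun i => pairTermK (E₁ i) (E₂ i) _ _ (termK₁ i) (termK₂ i)) Kdiff (fun _ _ => True)) :
    Thm314Printed c35 geo bg Kdiff dOmega :=
  thm314Printed_of_leaves_allNorms (fun i => pairLocData (D₁ i) (X₂ i) (Meets₂ i) _ _)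
    (fun i => pairLocData_laws (D₁ i) (L₁ i) (L₂ i) _ _) r₀ hr S hdΩ
    (diffExpansionAllNorms_pair _ _ _ (fun i => pairLocData_touches (D₁ i) (X₂ i) (Meets₂ i)) S
      (fun i _ _ _ hy hy' => wdist_nonneg_of_laws (D₁ i) (L₁ i) (S i) hy hy')
      (fun i _ _ _ hy hy' => wdist_nonneg_of_laws _ (L₂ i) (S i) hy hy') h₁ h₂) hSu

/-- **Both leaf fields of the certificate at once over the pair** (`t314` and `t314loc`). [cite: Balaban1985BackgroundPropagators, Thm 3.14 (3.154) pp.426–427] -/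
theorem thm314_pair_of_pair (D₁ : ∀ i, LocData (geo i) (bg i) (E₁ i))
    (X₂ : ∀ i, (E₂ i).Walk → ℕ → (geo i).Site → Prop) (Meets₂ : ∀ i, (E₂ i).Walk → ℕ → Prop)
    (L₁ : ∀ i, (D₁ i).Laws (dOmega i)) (L₂ : ∀ i, (locData₂ (D₁ i) (X₂ i) (Meets₂ i)).Laws (dOmega i)) (r₀ : ℝ)
    (hr : ∀ i, (D₁ i).diam ≤ r₀) (S : ∀ i, ModelSignsOn (geo i) (Ps i)) (hdΩ : ∀ (i : I) (y y' : (geo i).Site), 0 ≤ dOmega i y y')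
    (h₁ : Thm310AllNormsPrinted c35 geo bg E₁ termK₁) (h₂ : Thm310AllNormsPrinted c35 geo bg E₂ termK₂)
    (hSu : RWSumFactorYieldsSupL2 geo bg
      (fun i => pairExpansion (E₁ i) (E₂ i) (D₁ i).Touches (locData₂ (D₁ i) (X₂ i) (Meets₂ i)).Touches)
      (fun i => pairTermK (E₁ i) (E₂ i) _ _ (termK₁ i) (termK₂ i)) Kdiff (fun _ _ => True))
    (hS : RWSumFactorYieldsSupL2 geo bg
      (fun i => pairExpansion (E₁ i) (E₂ i) (D₁ i).Touches (locData₂ (D₁ i) (X₂ i) (Meets₂ i)).Touches)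
      (fun i => pairTermK (E₁ i) (E₂ i) _ _ (termK₁ i) (termK₂ i)) Kdiff OmK)
    (hH : RWSumFactorYieldsHolder geo bg
      (fun i => pairExpansion (E₁ i) (E₂ i) (D₁ i).Touches (locData₂ (D₁ i) (X₂ i) (Meets₂ i)).Touches)
      (fun i => pairTermK (E₁ i) (E₂ i) _ _ (termK₁ i) (termK₂ i)) Kdiff OmK) :
    Thm314Printed c35 geo bg Kdiff dOmega ∧ Thm314LocalPrinted c35 geo bg Kdiff OmK dOmega :=
  ⟨thm314Printed_of_pair D₁ X₂ Meets₂ L₁ L₂ r₀ hr S hdΩ h₁ h₂ hSu,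
    thm314LocalPrinted_of_pair D₁ X₂ Meets₂ L₁ L₂ r₀ hr S hdΩ h₁ h₂ hS hH⟩

end Rows

/-! ## §5 Rows 23 and 22 over the pair, with the structural reading of the summation (`B9Thm314WholeSummation`) -/

section RowsReading

variable {I : Type} {c35 : ℝ} {geo : I → Geometry} {bg : I → Backgrounds} {Kdiff : ∀ i, KernelFamily (geo i) (bg i)}
  {OmK : ∀ i, (geo i).Site → Prop} {dOmega : ∀ i, (geo i).Site → (geo i).Site → ℝ}
  {E₁ E₂ : ∀ i, RWExpansion (geo i) (bg i)}
  {termK₁ : ∀ i, (E₁ i).Walk → KernelFamily (geo i) (bg i)} {termK₂ : ∀ i, (E₂ i).Walk → KernelFamily (geo i) (bg i)}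
  {Ps : ∀ i, (geo i).Loc → Prop}

/-- ★ **ROWS 22 AND 23 OVER THE PAIR, SUMMATION READ STRUCTURALLY**: `B9Thm314WholeSummation.thm314_pair_of_reading` at the pair
expansion with the cancellation leaf supplied by `diffExpansionAllNorms_pair`.  Displayed: the two Theorem-3.10 all-norms leaves `h₁`, `h₂`;
the geometry (`D₁`, `X₂`, `Meets₂`, laws); the M-uniform diameter bound `hr` (flag T314 (ii) STANDS); the model signs, d(·,·,Ω) ≥ 0; and the
READING for the pair's walk sets — `WalkSetsSpec`, `WalkWeightsSummable`, and «both expansions converge at U ⇒ the difference family's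
quantities are dominated by the partial sums over the pair's walks» (`DominatedBySums`: the place of the operator identity behind the
cancellation).  Conclusion: `B9.Thm314Printed` (row 22) ∧ `B9Thm314.Thm314LocalPrinted` (row 23).  Nothing of print asserted; NOT a node
discharge. [cite: Balaban1985BackgroundPropagators, Thm 3.14 (3.154) pp.426–427] -/
theorem thm314_pair_of_pair_reading (D₁ : ∀ i, LocData (geo i) (bg i) (E₁ i))
    (X₂ : ∀ i, (E₂ i).Walk → ℕ → (geo i).Site → Prop) (Meets₂ : ∀ i, (E₂ i).Walk → ℕ → Prop)
    (L₁ : ∀ i, (D₁ i).Laws (dOmega i)) (L₂ : ∀ i, (locData₂ (D₁ i) (X₂ i) (Meets₂ i)).Laws (dOmega i)) (r₀ : ℝ)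
    (hr : ∀ i, (D₁ i).diam ≤ r₀) (S : ∀ i, ModelSignsOn (geo i) (Ps i)) (hdΩ : ∀ (i : I) (y y' : (geo i).Site), 0 ≤ dOmega i y y')
    (h₁ : Thm310AllNormsPrinted c35 geo bg E₁ termK₁) (h₂ : Thm310AllNormsPrinted c35 geo bg E₂ termK₂)
    (W : ∀ i, ℕ → (geo i).Site → (geo i).Site →
      Finset (pairExpansion (E₁ i) (E₂ i) (D₁ i).Touches (locData₂ (D₁ i) (X₂ i) (Meets₂ i)).Touches).Walk)
    (hW : ∀ i, WalkSetsSpec (pairExpansion (E₁ i) (E₂ i) (D₁ i).Touches (locData₂ (D₁ i) (X₂ i) (Meets₂ i)).Touches) (W i))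
    (hcnt : WalkWeightsSummable geo bg
      (fun i => pairExpansion (E₁ i) (E₂ i) (D₁ i).Touches (locData₂ (D₁ i) (X₂ i) (Meets₂ i)).Touches) W)
    (hdom : ∀ (i : I) (U : (bg i).Cfg), (E₁ i).Converges U ∧ (E₂ i).Converges U →
      DominatedBySums (pairExpansion (E₁ i) (E₂ i) (D₁ i).Touches (locData₂ (D₁ i) (X₂ i) (Meets₂ i)).Touches)
        (pairTermK (E₁ i) (E₂ i) _ _ (termK₁ i) (termK₂ i)) (Kdiff i) (W i) U) :
    Thm314Printed c35 geo bg Kdiff dOmega ∧ Thm314LocalPrinted c35 geo bg Kdiff OmK dOmega :=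
  thm314_pair_of_reading (fun i => pairLocData (D₁ i) (X₂ i) (Meets₂ i) _ _)
    (fun i => pairLocData_laws (D₁ i) (L₁ i) (L₂ i) _ _) r₀ hr S hdΩ
    (diffExpansionAllNorms_pair _ _ _ (fun i => pairLocData_touches (D₁ i) (X₂ i) (Meets₂ i)) S
      (fun i _ _ _ hy hy' => wdist_nonneg_of_laws (D₁ i) (L₁ i) (S i) hy hy')
      (fun i _ _ _ hy hy' => wdist_nonneg_of_laws _ (L₂ i) (S i) hy hy') h₁ h₂) W hW hcnt (fun i U hU => hdom i U hU)

end RowsReading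

end Literature.MathematicalPhysics.QuantumFieldTheory.Balaban1983to89.B9Thm314WholePair
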